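import Literature.AlgebraicGeometry.Pohlmann1968.CMTypeRankCharactersNumberField
import HarnessLib

/-!
# Characters of an elementary abelian `2`-group against odd subsets, and the parity obstruction to exceptional weights
# on `E × Y` (`E` a CM elliptic curve, `Y` nondegenerate with a multiquadratic CM field containing the CM field of `E`)

Companion of `NumberTheory/ComplexMultiplication/CMTypeRankCharacters` (Kubota's Lemma 2: for a CM type `Ψ` of a
finite COMMUTATIVE group `G` acting on itself, `rank(Ψ) = 1 + #{χ odd : Σ_{s∈Ψ} χ(s) ≠ 0}`; nondegenerate ⟺ no odd
character vanishes on `Ψ`, `IsCMTypeWith.typeRank_eq_iff_forall_oddCharacters`).  Here `G` has EXPONENT `2` (every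
complex character is `±1`-valued — the Galois group of a multiquadratic CM field `ℚ(√-d, √a₁, …, √a_r)`), and we
record the Fourier-analytic facts behind the following phenomenon (geometric face in
`Summits/HodgeConjecture/CorCM/CurveTimesMultiquadraticCMHodge`): for `E` an elliptic curve with CM by an imaginary
quadratic field `k ⊆ K` and `Y` a NONDEGENERATE abelian variety with CM by the multiquadratic field `K`, the product
`E × Y` carries NO exceptional "mixed" weight although `Hg(E × Y) ⊊ Hg(E) × Hg(Y)` (the Weil classes of `k` appear
only on `E² × Y`).

* `exists_oddCharacter_apply_ne_one` — an odd character (`χ(ρ) = −1`) non-trivial at a prescribed `h₀ ≠ 1`;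
* `sum_character_filter_mul_mem_eq_zero` — `Σ_{g : g c ∈ H} χ(g) = 0` for `χ` non-trivial on the subgroup `H`;
* `sum_character_mul_card_filter_eq` — the convolution identity
  `Σ_g χ(g) · #{h ∈ T | h g ∈ Ψ} = (Σ_{v∈Ψ} χ(v)) · (Σ_{h∈T} χ(h)⁻¹)`;
* `sum_character_ne_zero_of_odd_card` — in exponent `2`, `Σ_{h∈T} χ(h) ≠ 0` whenever `|T|` is ODD (an odd sum of `±1`);
* **`not_forall_card_filter_add_indicator_eq`** — the OBSTRUCTION: for `Ψ ⊆ G` a CM type on which no odd character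
  vanishes (nondegenerate), `H ≤ G` a subgroup with a non-trivial element, `T ⊆ G` of ODD size, `c ∈ G` and `p ∈ ℕ`, the
  counting function `g ↦ #{h ∈ T | h g ∈ Ψ} + [g c ∈ H]` is NOT constant `= p`.  (On `E × Y`: a `0/1`-weight with ONE
  embedding of `k` and the set `T` of embeddings of `K` would be Galois-balanced exactly when this function is constant;
  so no such weight exists, while `|T|` odd is forced by `|weight| = 2p`.)  Pairing the constant function with an odd
  `χ` non-trivial on `H` kills the `H`-coset term and the constant, leaving `(Σ_Ψ χ)(Σ_T χ) = 0` — impossible.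

Theorems only; no definition, no named fact; axioms `propext`, `Classical.choice`, `Quot.sound`.

## References
* [Kubota1965] T. Kubota, Trans. AMS 118 (1965), §4 Lemma 2 (characters `ψ` with `ψ(ρ) = −1`, `Σ ψ(σᵢ) = 0`).
* [Gordon1999HodgeAVSurvey] B. B. Gordon, *A survey of the Hodge conjecture for abelian varieties*, 9.4.1–9.4.2, §9.2 (9.2.1).
* [MoonenZarhin1999LowDim] B. Moonen, Yu. Zarhin, Math. Ann. 315 (1999) 711–733, §3 (3.1), Thm. (0.2).
-/

set_option autoImplicit false

noncomputable section

open scoped BigOperators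

namespace Literature.NumberTheory.ComplexMultiplication

open AddChar

variable {G : Type*} [CommGroup G] [Fintype G] [DecidableEq G]

/-! ### §1 Characters: values `±1`, a non-trivial odd character, vanishing over cosets -/

omit [Fintype G] [DecidableEq G] in
/-- `χ(g) = ±1` when `g² = 1`. [cite: Kubota1965, §4 Lemma 2 (proof)] -/
theorem character_apply_eq_one_or_of_mul_self (χ : AddChar (Additive G) ℂ) {g : G} (hg : g * g = 1) :
    χ (Additive.ofMul g) = 1 ∨ χ (Additive.ofMul g) = -1 := by
  have h1 : χ (Additive.ofMul g) * χ (Additive.ofMul g) = 1 := by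
    rw [← map_add_eq_mul, ← ofMul_mul, hg, ofMul_one, map_zero_eq_one]
  exact mul_self_eq_one_iff.1 h1

omit [Fintype G] [DecidableEq G] in
/-- In exponent `2`, `χ(g)⁻¹ = χ(g)`. [cite: Kubota1965, §4 Lemma 2 (proof)] -/
theorem character_apply_inv_eq_of_exponent_two (hexp : ∀ g : G, g * g = 1) (χ : AddChar (Additive G) ℂ) (g : G) :
    (χ (Additive.ofMul g))⁻¹ = χ (Additive.ofMul g) := by
  rcases character_apply_eq_one_or_of_mul_self χ (hexp g) with h | h <;> rw [h] <;> norm_num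

omit [DecidableEq G] in
/-- **An odd character non-trivial at a prescribed element.**  For an involution `ρ ≠ 1` and any `h₀ ≠ 1` there is a
character `χ` with `χ(ρ) = −1` and `χ(h₀) ≠ 1` (characters separate points; multiply an odd character by one that
sees `h₀` if necessary). [cite: Kubota1965, §4 Lemma 2 (proof)] -/
theorem exists_oddCharacter_apply_ne_one {ρ h₀ : G} (hρ1 : ρ ≠ 1) (hρ2 : ρ * ρ = 1) (hh₀ : h₀ ≠ 1) :
    ∃ χ : AddChar (Additive G) ℂ, χ (Additive.ofMul ρ) = -1 ∧ χ (Additive.ofMul h₀) ≠ 1 := by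
  classical
  have hρ0 : Additive.ofMul ρ ≠ 0 := fun h => hρ1 (by simpa using congrArg Additive.toMul h)
  have hh0 : Additive.ofMul h₀ ≠ 0 := fun h => hh₀ (by simpa using congrArg Additive.toMul h)
  obtain ⟨χ₁, hχ₁⟩ := (AddChar.exists_apply_ne_zero (α := Additive G)).2 hρ0
  have hχ₁' : χ₁ (Additive.ofMul ρ) = -1 := (character_apply_eq_one_or_of_mul_self χ₁ hρ2).resolve_left hχ₁
  by_cases h1 : χ₁ (Additive.ofMul h₀) ≠ 1
  · exact ⟨χ₁, hχ₁', h1⟩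
  rw [not_not] at h1
  obtain ⟨χ₂, hχ₂⟩ := (AddChar.exists_apply_ne_zero (α := Additive G)).2 hh0
  rcases character_apply_eq_one_or_of_mul_self χ₂ hρ2 with he | ho
  · refine ⟨χ₁ + χ₂, ?_, ?_⟩
    · rw [AddChar.add_apply, hχ₁', he, mul_one]
    · rw [AddChar.add_apply, h1, one_mul]; exact hχ₂
  · exact ⟨χ₂, ho, hχ₂⟩

omit [DecidableEq G] in
/-- **A character non-trivial on a subgroup sums to zero over each of its cosets**: `Σ_{g : g c ∈ H} χ(g) = 0` if
`χ(h₀) ≠ 1` for some `h₀ ∈ H` (translation by `h₀` permutes `{g | g c ∈ H}`). [cite: Kubota1965, §4 Lemma 2 (proof)] -/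
theorem sum_character_filter_mul_mem_eq_zero (H : Subgroup G) [DecidablePred (· ∈ H)] (χ : AddChar (Additive G) ℂ)
    {h₀ : G} (hh₀H : h₀ ∈ H) (hχ : χ (Additive.ofMul h₀) ≠ 1) (c : G) :
    ∑ g ∈ Finset.univ.filter (fun g : G => g * c ∈ H), χ (Additive.ofMul g) = 0 := by
  set S := ∑ g ∈ Finset.univ.filter (fun g : G => g * c ∈ H), χ (Additive.ofMul g) with hS
  -- `χ(h₀) S = S` by the reindexing `g ↦ h₀ g`
  have hre : χ (Additive.ofMul h₀) * S = S := by
    rw [hS, Finset.mul_sum]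
    refine Finset.sum_nbij' (fun g => h₀ * g) (fun g => h₀⁻¹ * g) ?_ ?_ ?_ ?_ ?_
    · intro g hg
      simp only [Finset.mem_filter, Finset.mem_univ, true_and] at hg ⊢
      rw [mul_assoc]
      exact H.mul_mem hh₀H hg
    · intro g hg
      simp only [Finset.mem_filter, Finset.mem_univ, true_and] at hg ⊢
      rw [mul_assoc]
      exact H.mul_mem (H.inv_mem hh₀H) hg
    · intro g _; rw [← mul_assoc, inv_mul_cancel, one_mul]
    · intro g _; rw [← mul_assoc, mul_inv_cancel, one_mul]
    · intro g _
      rw [ofMul_mul, map_add_eq_mul]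
  have h1 : (χ (Additive.ofMul h₀) - 1) * S = 0 := by rw [sub_mul, hre, one_mul, sub_self]
  rcases mul_eq_zero.1 h1 with h | h
  · exact absurd (sub_eq_zero.1 h) hχ
  · exact h

omit [DecidableEq G] in
/-- `Σ_{g∈G} χ(g) = 0` for `χ ≠ 1` (orthogonality; Mathlib `AddChar.sum_eq_zero_iff_ne_zero` on `Additive G`).
[cite: Kubota1965, §4 Lemma 2 (proof)] -/
theorem sum_character_eq_zero_of_ne_zero {χ : AddChar (Additive G) ℂ} (hχ : χ ≠ 0) :
    ∑ g : G, χ (Additive.ofMul g) = 0 := by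
  have h := (AddChar.sum_eq_zero_iff_ne_zero (ψ := χ)).2 hχ
  rw [← h]
  exact (Fintype.sum_equiv Additive.ofMul _ _ fun x => rfl)

/-! ### §2 The convolution identity and odd subsets -/

/-- **Convolution identity**: `Σ_g χ(g) · #{h ∈ T | h g ∈ Ψ} = (Σ_{v∈Ψ} χ(v)) · (Σ_{h∈T} χ(h)⁻¹)` (substitute
`v = h g`). [cite: Kubota1965, §4 Lemma 2 (proof)] -/
theorem sum_character_mul_card_filter_eq (χ : AddChar (Additive G) ℂ) (T Ψ : Finset G) :
    ∑ g : G, χ (Additive.ofMul g) * ((T.filter fun h => h * g ∈ Ψ).card : ℂ) =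
      (∑ v ∈ Ψ, χ (Additive.ofMul v)) * ∑ h ∈ T, (χ (Additive.ofMul h))⁻¹ := by
  -- expand the cardinality as a sum of indicators and swap
  have h1 : ∀ g : G, ((T.filter fun h => h * g ∈ Ψ).card : ℂ) = ∑ h ∈ T, if h * g ∈ Ψ then (1 : ℂ) else 0 := by
    intro g
    rw [Finset.sum_boole]
  simp_rw [h1, Finset.mul_sum, mul_ite, mul_one, mul_zero]
  rw [Finset.sum_comm]
  refine Finset.sum_congr rfl fun h _ => ?_
  -- inner sum: `Σ_g χ(g) [h g ∈ Ψ] = Σ_{v ∈ Ψ} χ(h⁻¹ v) = χ(h)⁻¹ Σ_{v∈Ψ} χ(v)`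
  rw [← Finset.sum_filter]
  have h2 : ∑ g ∈ Finset.univ.filter (fun g : G => h * g ∈ Ψ), χ (Additive.ofMul g) =
      ∑ v ∈ Ψ, χ (Additive.ofMul (h⁻¹ * v)) := by
    refine Finset.sum_nbij' (fun g => h * g) (fun v => h⁻¹ * v) ?_ ?_ ?_ ?_ ?_
    · intro g hg
      simpa only [Finset.mem_filter, Finset.mem_univ, true_and] using hg
    · intro v hv
      simp only [Finset.mem_filter, Finset.mem_univ, true_and]
      rwa [← mul_assoc, mul_inv_cancel, one_mul]
    · intro g _; rw [← mul_assoc, inv_mul_cancel, one_mul]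
    · intro v _; rw [← mul_assoc, mul_inv_cancel, one_mul]
    · intro g _; rw [← mul_assoc, inv_mul_cancel, one_mul]
  rw [h2, Finset.sum_mul]
  refine Finset.sum_congr rfl fun v _ => ?_
  rw [ofMul_mul, map_add_eq_mul, ofMul_inv, map_neg_eq_inv, mul_comm]

omit [Fintype G] [DecidableEq G] in
/-- **Odd subsets are seen by every character, in exponent `2`**: `Σ_{h∈T} χ(h) ≠ 0` when `|T|` is odd (each term is
`±1`, and an odd number of signs does not cancel). [cite: Gordon1999HodgeAVSurvey, 9.4.2] -/
theorem sum_character_ne_zero_of_odd_card (hexp : ∀ g : G, g * g = 1) (χ : AddChar (Additive G) ℂ) (T : Finset G)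
    (hT : Odd T.card) : ∑ h ∈ T, χ (Additive.ofMul h) ≠ 0 := by
  -- split `T` by the sign of `χ`
  set P := T.filter fun h => χ (Additive.ofMul h) = 1 with hP
  set M := T.filter fun h => ¬ χ (Additive.ofMul h) = 1 with hM
  have hsum : ∑ h ∈ T, χ (Additive.ofMul h) = (P.card : ℂ) - (M.card : ℂ) := by
    rw [← Finset.sum_filter_add_sum_filter_not T (fun h => χ (Additive.ofMul h) = 1)]
    have h1 : ∑ h ∈ P, χ (Additive.ofMul h) = ∑ h ∈ P, (1 : ℂ) :=
      Finset.sum_congr rfl fun h hh => (Finset.mem_filter.1 hh).2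
    have h2 : ∑ h ∈ M, χ (Additive.ofMul h) = ∑ h ∈ M, (-1 : ℂ) :=
      Finset.sum_congr rfl fun h hh =>
        (character_apply_eq_one_or_of_mul_self χ (hexp h)).resolve_left (Finset.mem_filter.1 hh).2
    rw [← hP, ← hM, h1, h2, Finset.sum_const, Finset.sum_const, nsmul_eq_mul, mul_one, nsmul_eq_mul, mul_neg,
      mul_one, sub_eq_add_neg]
  have hcard : P.card + M.card = T.card := by
    rw [hP, hM]
    exact Finset.card_filter_add_card_filter_not _
  rw [hsum]
  intro h0
  have hPM : P.card = M.card := by exact_mod_cast sub_eq_zero.1 h0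
  rw [hPM, ← two_mul] at hcard
  exact (Nat.not_even_iff_odd.2 hT) ⟨M.card, by omega⟩

/-! ### §3 The obstruction: no odd `T` has constant shifted counts against a nondegenerate type -/

/-- **Parity obstruction to exceptional weights on `E × Y`.**  Let `G` be a finite commutative group of exponent `2`,
`ρ ∈ G` and `Ψ ⊆ G` a CM type for `ρ` on which NO odd character vanishes (nondegenerate, Kubota's Lemma 2), `H ≤ G` a
subgroup containing some `h₀ ≠ 1`, `T ⊆ G` of ODD size, `c ∈ G`, `p ∈ ℕ`.  Then the function
`g ↦ #{h ∈ T | h g ∈ Ψ} + [g c ∈ H]` is not constant equal to `p`: pairing with an odd `χ` non-trivial on `H`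
(`exists_oddCharacter_apply_ne_one`) kills the constant and the coset term and leaves `(Σ_Ψ χ)(Σ_T χ) = 0`,
contradicting nondegeneracy and `|T|` odd.  (For `K` a multiquadratic CM field, `k ⊆ K` imaginary quadratic with
`H = Gal(K/k)`, this is the statement that no `0/1`-weight on `Hom(k,ℂ) ⊔ Hom(K,ℂ)` with exactly one embedding of `k` is
Galois balanced: the mixed part of `H^{2p}(E × Y)` carries no Hodge class.) [cite: Kubota1965, §4 Lemma 2]
[cite: MoonenZarhin1999LowDim, §3 (3.1) and Thm. (0.2)] -/
theorem not_forall_card_filter_add_indicator_eq (hexp : ∀ g : G, g * g = 1) {ρ : G} {Ψ : Finset G}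
    (hΨ : IsCMTypeWith ρ (Ψ : Set G))
    (hnd : ∀ χ : AddChar (Additive G) ℂ, χ (Additive.ofMul ρ) = -1 → ∑ v ∈ Ψ, χ (Additive.ofMul v) ≠ 0)
    (H : Subgroup G) [DecidablePred (· ∈ H)] {h₀ : G} (hh₀H : h₀ ∈ H) (hh₀ : h₀ ≠ 1)
    (T : Finset G) (hT : Odd T.card) (c : G) (p : ℕ) :
    ¬ ∀ g : G, (T.filter fun h => h * g ∈ Ψ).card + (if g * c ∈ H then 1 else 0) = p := by
  intro hconst
  have hρ1 : ρ ≠ 1 := by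
    intro hρ
    have := hΨ.rho_smul_ne (1 : G)
    rw [hρ, smul_eq_mul, one_mul] at this
    exact this rfl
  obtain ⟨χ, hχρ, hχh₀⟩ := exists_oddCharacter_apply_ne_one hρ1 (hexp ρ) hh₀
  have hχ0 : χ ≠ 0 := by
    intro h
    rw [h, AddChar.zero_apply] at hχρ
    norm_num at hχρ
  -- pair the constant function with `χ`
  have hpair : ∑ g : G, χ (Additive.ofMul g) * (((T.filter fun h => h * g ∈ Ψ).card : ℂ) +
      (if g * c ∈ H then (1 : ℂ) else 0)) = 0 := by
    have h1 : ∀ g : G, (((T.filter fun h => h * g ∈ Ψ).card : ℂ) + (if g * c ∈ H then (1 : ℂ) else 0)) = (p : ℂ) := by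
      intro g
      have := hconst g
      split_ifs at this ⊢ with hg
      · exact_mod_cast this
      · exact_mod_cast this
    simp_rw [h1, ← Finset.sum_mul, sum_character_eq_zero_of_ne_zero hχ0, zero_mul]
  -- the coset term vanishes
  have hcoset : ∑ g : G, χ (Additive.ofMul g) * (if g * c ∈ H then (1 : ℂ) else 0) = 0 := by
    simp_rw [mul_ite, mul_one, mul_zero]
    rw [← Finset.sum_filter]
    exact sum_character_filter_mul_mem_eq_zero H χ hh₀H hχh₀ c
  -- hence the convolution term vanishes: `(Σ_Ψ χ)(Σ_T χ⁻¹) = 0`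
  have hconv : (∑ v ∈ Ψ, χ (Additive.ofMul v)) * ∑ h ∈ T, (χ (Additive.ofMul h))⁻¹ = 0 := by
    rw [← sum_character_mul_card_filter_eq]
    have h := hpair
    simp_rw [mul_add, Finset.sum_add_distrib, hcoset, add_zero] at h
    exact h
  rcases mul_eq_zero.1 hconv with h | h
  · exact hnd χ hχρ h
  · simp_rw [character_apply_inv_eq_of_exponent_two hexp] at h
    exact sum_character_ne_zero_of_odd_card hexp χ T hT h

end Literature.NumberTheory.ComplexMultiplication

end
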